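import Mathlib.RingTheory.MvPolynomial.Homogeneous
import Mathlib.RingTheory.Ideal.Span
import Mathlib.Data.Fintype.Card
import HarnessLib

/-!
# The Briançon–Skoda theorem for polynomial rings (named fact)

Topic `Literature/RingTheory/IntegralClosure` (integral closure of IDEALS; Huneke–Swanson,
*Integral Closure of Ideals, Rings, and Modules*, LMS LN 336, CUP 2006 — [HunekeSwanson2006]).

Recall (H–S **Definition 1.1.1**): for an ideal `I` of a commutative ring `R`, an element `r ∈ R` is
*integral over `I`* if `r^k + a₁ r^{k-1} + ⋯ + a_k = 0` for some `k ≥ 1` and `a_j ∈ I^j`; the set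
`Ī` of such elements is an ideal, the integral closure of `I` (H–S Cor. 1.3.1), and
`Ī · J̄ ⊆ \overline{IJ}` (H–S Remark 1.3.2 (4)).

**Briançon–Skoda theorem** (Briançon–Skoda 1974 for `ℂ{z₁,…,z_d}` via Skoda's `L²` division;
Lipman–Sathaye 1981 for all regular rings, H–S **Theorem 13.3.3**: `R` regular, `I` generated by `l`
elements ⇒ `\overline{I^{n+l}} ⊆ I^{n+1}` for all `n ≥ 0`; and H–S **Corollary 13.3.4**: `R` regular
of dimension `d`, `I` ANY ideal ⇒ `\overline{I^{d+n}} ⊆ I^{n+1}` for all `n ≥ 0`).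

In particular, for the polynomial ring `R = K[σ]` over a field `K` in `d = #σ ≥ 1` variables (a
regular ring of dimension `d`) and any ideal `I`: if `f ∈ Ī` then `f^d ∈ Ī^d ⊆ \overline{I^d} ⊆ I`
(Cor. 13.3.4 with `n = 0`). This file records that consequence as a NAMED FACT (`def … : Prop`,
D-0014), in the concrete shape in which an equation of integral dependence is usually PRODUCED:
a homogeneous polynomial relation. If `Φ ∈ K[Y_ι, T]` is homogeneous of degree `k`, then
`Φ = c·T^k + ∑_{j=1}^{k} Φ_j(Y) T^{k-j}` with `Φ_j ∈ K[Y]` homogeneous of degree `j` and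
`c = Φ(0, 1)`; so `Φ(G, f) = 0` for a family `G : ι → R` and `f ∈ R` reads
`c f^k + Φ₁(G) f^{k-1} + ⋯ + Φ_k(G) = 0` with `Φ_j(G) ∈ I^j`, `I = (G_i)_i` — for `c ≠ 0` an equation
of integral dependence of `f` over `I` (divide by `c`; `k ≥ 1` automatically, since for `k = 0` the
two hypotheses `Φ(0,1) ≠ 0`, `Φ(G,f) = 0` contradict each other). Hence the statement below is
exactly "f ∈ Ī ⇒ f^d ∈ I" restricted to integral equations with coefficients that are `K`-polynomial
in the generators, which is all that users constructing the relation from a polynomial identity need.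

Edge cases: `d ≥ 1` is required (`[Nonempty σ]`): for `d = 0`, `I = 0`, `f = 0` the conclusion
`f^0 = 1 ∈ 0` fails although `0 ∈ \overline{0}` (Cor. 13.3.4 is about `I^{d+n}` with `d = dim R`,
and `\overline{I^0} = R`). `ι` may be infinite (only finitely many `G_i` occur in `Φ`; integrality
over the sub-ideal they generate implies integrality over `I`). Any field `K` (H–S Cor. 13.3.4 has no
residue-field hypothesis: it passes to `R(t)`).

## Why it is here

Route ValiantsHypothesis/RefutationDegree, crux `CertWindowQP`, line `Sketch` (v2): a separating
equation for the padded permanent off the determinant orbit closure, pulled back along the pencil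
map and homogenised, is an integral equation of `T^m` over the homogenised equations of the
determinantal-representability system; Briançon–Skoda turns it into `T^{m(N+1)} ∈ (G_μ)`, i.e. a
Nullstellensatz refutation of degree LINEAR in the number of unknowns — the algebraic counterpart of
the Skoda–Brownawell degree bound (`Literature/RingTheory/Nullstellensatz/SkodaBrownawellDegreeBound.lean`)
at Łojasiewicz exponent `0`. Proving the fact in Lean needs the Lipman–Sathaye theorem (regular rings,
Jacobian ideals; or tight closure plus reduction to characteristic `p`, Hochster–Huneke 1990 §5) —
neither is in Mathlib; the tree's `Literature/RingTheory/TightClosure/` has the characteristic-`p`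
vocabulary only.

## What is NOT here

The notion `Ideal.integralClosure` itself and its API (reductions, Rees valuations), the general
Lipman–Sathaye theorem for regular rings, the `I^{n+1}` versions (`n > 0`), the module / joint
reduction / adjoint variants (H–S 13.4, 17.8.7, 18.2.3), and the analytic original.
`-- TODO(general form): R regular of finite Krull dimension d, I ≤ R, f ∈ Ī ⇒ f ^ d ∈ I (H–S Cor. 13.3.4).`

## References

* [HunekeSwanson2006] C. Huneke, I. Swanson, *Integral Closure of Ideals, Rings, and Modules*,
  LMS Lecture Note Series 336, CUP 2006: Def. 1.1.1, Rem. 1.3.2 (4), Thm. 13.3.3, Cor. 13.3.4.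
* J. Lipman, A. Sathaye, *Jacobian ideals and a theorem of Briançon–Skoda*, Michigan Math. J. 28
  (1981) 199–222.
* J. Briançon, H. Skoda, *Sur la clôture intégrale d'un idéal de germes de fonctions holomorphes en
  un point de ℂⁿ*, C. R. Acad. Sci. Paris Sér. A 278 (1974) 949–951.
* [HochsterHuneke1990] M. Hochster, C. Huneke, *Tight closure, invariant theory, and the
  Briançon–Skoda theorem*, J. AMS 3 (1990) 31–116, §5.
-/

namespace Literature.RingTheory.IntegralClosure

/-- **Briançon–Skoda theorem for polynomial rings** (named fact; Lipman–Sathaye's theorem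
specialised to `K[σ]`, Huneke–Swanson Cor. 13.3.4 with `n = 0`). Let `K` be a field, `σ` a finite
nonempty type of `d = #σ` variables, `G : ι → K[σ]` any family and `f ∈ K[σ]`. Suppose `f` satisfies
a homogeneous polynomial relation over the `G_i`: there is `Φ ∈ K[Option ι]` (variables `some i` for
the `G_i`, `none` for `f`), homogeneous of degree `k`, with `Φ(0, …, 0; 1) ≠ 0` (the coefficient of
the pure power of the `f`-variable) and `Φ(G; f) = 0` — equivalently (module docstring) an equation
of integral dependence `c f^k + Φ₁(G) f^{k-1} + ⋯ + Φ_k(G) = 0`, `c ≠ 0`, `Φ_j(G) ∈ I^j`, of `f` over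
the ideal `I = (G_i)_i` (H–S Def. 1.1.1). Then `f ^ d ∈ I`: `f ∈ Ī`, hence
`f^d ∈ Ī^d ⊆ \overline{I^d} ⊆ I` by Briançon–Skoda for the regular ring `K[σ]` of dimension `d`.
[cite: HunekeSwanson2006, Cor. 13.3.4 (n = 0), with Def. 1.1.1 and Rem. 1.3.2 (4)] -/
def brianconSkodaPolynomialRing : Prop :=
  ∀ (K : Type) [Field K] (σ ι : Type) [Fintype σ] [Nonempty σ]
    (G : ι → MvPolynomial σ K) (f : MvPolynomial σ K) (k : ℕ) (Φ : MvPolynomial (Option ι) K),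
    Φ.IsHomogeneous k →
    MvPolynomial.eval (fun o : Option ι => o.elim 1 fun _ => 0) Φ ≠ 0 →
    MvPolynomial.aeval (fun o : Option ι => o.elim f G) Φ = 0 →
    f ^ Fintype.card σ ∈ Ideal.span (Set.range G)

end Literature.RingTheory.IntegralClosure
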